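import Summits.QuantumFields.BalabanUV.Beta.D1BFx.FineHessianWard
import Summits.QuantumFields.BalabanUV.Beta.D1BFx.GhostStencilRootedReflection
import Summits.QuantumFields.BalabanUV.Beta.D1BFx.GhostLegWardRooted

/-!
# `BalabanUV.Beta.D1BFx.GhostKernelRooted` — road «BF-x» for binder row D1, sub-leaf T7-gh v1.1 (OWNER RULINGS #1, R-4 (iii)):
# LEAF-04's GHOST FINE ONE-SHOT KERNEL RE-INSTANTIATED ON THE RULED TRIPLE `(Ggh n a, SghAt (ctrHalf n) n cK cQ, (cW/2) • ghX)` —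
# `PghR n a cK cQ cW := TOfGh n a (SghAt (ctrHalf n) n cK cQ) (tableRedF n (diagExt (ghXTab cW)))` — with every structural socket
# of the generic sandwich / K-R5 chain DISCHARGED, and the PARITY input of the A4 END DISCHARGED for ODD `n` (the point of the re-rooting)

HONEST DEPENDENCY (page 1, mandatory): continuum YM on T⁴ ⇐ BetaPertH ∧ nine spine estimates (0/9 proved); BetaPertH ⇐ (D1) ∧ (D4) ∧
CAP+tail; G-an2-4 gates asym, D1 and NE2/3/4.  HONEST FRAMING (cell contract, verbatim): «discharging `BetaPertH` makes Bałaban's UV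
stability UNCONDITIONAL — a real constructive-QFT result; it is NOT the continuum limit and NOT the Clay problem.»  THIS MODULE DISCHARGES
NOTHING of the wall: three definitions with bodies ([our objects] `ghXTab`, `PghR`, `fineHessGhR` — asserting nothing) and [folklore]
bookkeeping BY NAME over the tree: leaf-01's centre-rooted stencil `GhostStencilRooted.SghAt` / `GhostStencilRootedReflection.ctrHalf` /
`SghAt_pointInversion`, its reversal-symmetric contact `GhostStencilReflection.ghX` / `smul_ghX_pointInversion`, its (W1) law
`GhostLegWardRooted.ward₁_Ggh_rooted`, the typer's ghost leg `GhostLeg.Ggh` (`spr_Ggh`, `shiftK_Ggh_neg`, `decays_Ggh`,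
`GhostLegReflection.refK_invLeg_Ggh`), leaf-04's T8-gh `ReducedKernelF.TOfGh` and the A4-leg chain (`ReducedTableF`,
`ReducedKernelSandwichBlock`, `FineHessianReflection`, `FineHessianWard`).  No `def … : Prop`, no citation, nothing printed asserted;
0 binders of the hR root touched; 0 sorry.  NOT summit progress; NOT BetaPertH, NOT continuum, NOT Clay.

ABSOLUTE RULE (cell, verbatim): «No internally-minted statement may enter as a cited fact. Every hypothesis is either kernel-proved in this
package or a verbatim quotation of a PUBLISHED theorem with page reference. The manuscript(s) under audit are NOT citable for their own
disputed steps — they are the thing under adjudication; programme-internal (2001/route/tribunal) claims are never citable.»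

WHY (owner `HOME/b2b-balaban-beta-d1-p2/OWNER-RULINGS-1.md` R-4, verbatim in substance): (i) the ghost second-order KINETIC table of record
is the exponential transporter's cross contact `diagExt (κ u ↦ (cW/2) • ghX κ u)` (leaf-01: T6 v1's head contact `ghCnt` fails both the
parity and the (W2) sockets, `ghX` passes both); (ii) the first-order ghost stencil of record is the CENTRE-ROOTED `SghAt (ctrHalf n) n cK cQ`,
`n` ODD (B12 p. 251 «L is an odd, positive integer … a center at y» is the locator; the road pursues odd blocking first); (iii) «T7-gh of
record := `GhostKernel.Pgh` RE-INSTANTIATED on `(Ggh n a, SghAt (ctrHalf n) n cK cQ, (cW/2)•ghX)` — first refusal the leaf-04 lineage's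
successor … the generic `TOfGh_…`/`ReducedKernelSandwichLeg` ENDs take the triple BY NAME».  This file is that re-instantiation.

CONTENT.
* §1 [our object] `ghXTab cW κ u := (cW/2) • ghX κ u` and its [folklore] sockets at the common rate `1/n` (`biLoc_ghXTab`,
  `biLoc_diagExt_ghXTab`, block covariance, symmetry of the diagonal extension) and its INVERSION LAW with the current's offset
  (`ghXTab_pointInversion`, `diagExt_ghXTab_pointInversion` — from leaf-01's `smul_ghX_pointInversion` + `FineHessianReflection.diagExt_refl`);
  the centre-rooted stencil's sockets at rate `1/n` (`biLoc_SghAt_ctr`, `SghAt_ctr_translate_block`).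
* §2 [folklore] **THE CENTRED GHOST SECTOR OVER A GENERIC FINE TWO-BOND TABLE `Wf`** (the durable form — any Q-sector completion of the
  table plugs in here): `bondSecondMoment_TOfGh_ctr_eq_avgM2_of_tableLaw` — for ODD `n`, a symmetric, block-covariant fine table
  bi-localised at rate `1/n` obeying the inversion law `Wf κ (cInv n κ − u) λ (cInv n λ − u′) = refK (invLeg n) (Wf κ u λ u′)` ⟹ the coarse
  bond second moment of `TOfGh n a (SghAt (ctrHalf n) n cK cQ) (tableRedF n Wf)` is the base-point block average `avgM2` of the fine one
  GIVEN ONLY the Ward rows `hrow` (parity DISCHARGED: `SghAt_pointInversion`, `refK_invLeg_Ggh`, `FineHessianReflection.fineHessA_inversion`);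
  `bondSecondMoment_TOfGh_ctr_eq_avgM2_of_laws` — the SOCKET-ONLY form on the Ward ray `(cK, cQ) = (c·n², c·a)`: (W1) DISCHARGED by
  `ward₁_Ggh_rooted` with `X u = (−c) • genX u`; the ONE remaining table-side law is (W2) `divW Wf u λ u′ = X u ∘ SghAt λ u′ − SghAt λ u′ ∘ X u`.
* §3 [our objects] **THE RULED LITERAL** `PghR`, `fineHessGhR` and [folklore] `PghR_eq_TOfLeg`, `blockCovariant_PghR`, `hess_eq_PghR`,
  `absMoment₂_PghR`, `exists_decay510_PghR` (`0 < a`; NO other hypothesis; constants per `n`), `PghR_eq_dressedEntryP`,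
  `bondSecondMoment_PghR_eq_avgM2` / `secondMoment_PghR_eq` (hypotheses `hrow`, `hT1` as in `GhostKernelSandwich`), and
  **`bondSecondMoment_PghR_eq_avgM2_of_wardRows`** (ODD `n`: the parity input DISCHARGED — only `hrow` remains).
* §4 [folklore] `ward₁_SghAt_ctr` — (W1) for the triple's leg and stencil on the ray, for the record.
HONEST SCOPE OF THE WARD SIDE (for the owner; nothing asserted beyond the theorems): leaf-01's `GhostStencilWard.ward₂_ghX` is the (W2) law
of the table `c′ • ghX` against the PURE CURRENT `Sgh n c′ 0` (contact weight = current weight).  On the ray `(cK, cQ) = (c·n², c·a)` with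
`c ≠ 0` the stencil carries the `Q′(U)`-jet `c·a • qAntiAt`, whose commutator with `genX u` is not the divergence of any one-bond diagonal
table, so (W2) — and with it the Ward rows `hrow` derived from (W1)+(W2) by `FineHessianWard.hasSum_row_fineHessA_of_wardLaws` — is NOT
available for the literal kinetic-only table `diagExt (ghXTab cW)` at `cQ ≠ 0`: the `Q′(U)` second-jet (mass-sector) two-bond table is not
part of T6 v1.1.  Hence for the literal `PghR` the Ward rows stay the named hypothesis `hrow` (node A3.b), exactly as for `GhostKernel.Pgh`;
§2 is stated over a generic `Wf` so that a completed table `diagExt (ghXTab cW) + (Q-sector table)` feeds the same theorems by name.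
Unit `b2b-balaban-beta-d1-formalise-leaf-04` (gen 2).
-/

noncomputable section

namespace Summit.QuantumFields.BalabanUV.Beta.D1BFx.GhostKernelRooted

open Finset
open scoped BigOperators
open Literature.MathematicalPhysics.QuantumFieldTheory.Balaban1983to89
open Literature.MathematicalPhysics.QuantumFieldTheory.Balaban1983to89.Beta
open B12Sec2to5 (l1 l1_nonneg Decay510)
open B6QGQDecay237 (deltaU deltaU_pos)
open ExpKernelCalculus (Site MKer Decays BiLoc VertexFamily VertexFamily₂ comp shiftK BlockCovariant hess hessKer hess_eq_hessKer
  hdec_hessKer)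
open DecimatedMomentSummable (AbsMoment₂)
open DressedMomentNormalisation (resSite)
open MinimiserIdentityForm (wK)
open KernelReflection (LegMap refK)
open KernelWard (divV divW)
open OneStepResolventKernel (decays_mono biLoc_mono)
open Summit.QuantumFields.BalabanUV.Beta.TameKernelCalculus (Spr)
open Summit.QuantumFields.BalabanUV.Beta.D1BFx.GhostLeg (Ggh spr_Ggh shiftK_Ggh_neg decays_Ggh const_nonneg)
open Summit.QuantumFields.BalabanUV.Beta.D1BFx.GhostLegReflection (invLeg refK_invLeg_Ggh)
open Summit.QuantumFields.BalabanUV.Beta.D1BFx.GhostStencilReflection (ghX ghX_translate biLoc_ghX smul_ghX_pointInversion cInv)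
open Summit.QuantumFields.BalabanUV.Beta.D1BFx.GhostStencilRooted (SghAt biLoc_SghAt SghAt_translate_block)
open Summit.QuantumFields.BalabanUV.Beta.D1BFx.GhostStencilRootedReflection (ctrHalf ctrHalf_mem SghAt_pointInversion)
open Summit.QuantumFields.BalabanUV.Beta.D1BFx.GhostStencilWard (genX)
open Summit.QuantumFields.BalabanUV.Beta.D1BFx.GhostLegWard (biLoc_smul_genX)
open Summit.QuantumFields.BalabanUV.Beta.D1BFx.GhostLegWardRooted (ward₁_Ggh_rooted)
open Summit.QuantumFields.BalabanUV.Beta.D1BFx.ReducedKernelF (vertexRedF TOfLeg TOfGh vertexFamily_vertexRedF' absMoment₂_TOfGh)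
open Summit.QuantumFields.BalabanUV.Beta.D1BFx.ReducedTableF (tableRedF vertexFamily₂_tableRedF' tableRedF_translate)
open Summit.QuantumFields.BalabanUV.Beta.D1BFx.GhostKernel (biLoc_smul' shiftK_smul vertexRedF_translate_block)
open Summit.QuantumFields.BalabanUV.Beta.D1BFx.MomentTransferPeriodic (baseKer)
open Summit.QuantumFields.BalabanUV.Beta.D1BFx.MomentTransferPeriodicEntry (EKer₂ dressedEntryP avgM2)
open Summit.QuantumFields.BalabanUV.Beta.D1BFx.ReducedKernelSandwichLeg (fineHessA)
open Summit.QuantumFields.BalabanUV.Beta.D1BFx.ReducedKernelSandwichBlock (diagExt diagExt_symm biLoc_diagExt diagExt_translate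
  TOfLeg_tableRedF_eq_dressedEntryP_of_block bondSecondMoment_TOfLeg_eq_avgM2_of_block secondMoment_TOfLeg_eq_of_block)
open Summit.QuantumFields.BalabanUV.Beta.D1BFx.FineHessianReflection (diagExt_refl bondSecondMoment_TOfLeg_eq_avgM2_of_refl)
open Summit.QuantumFields.BalabanUV.Beta.D1BFx.FineHessianWard (bondSecondMoment_TOfLeg_eq_avgM2_of_laws)

/-! ## §1 The ruled kinetic contact table; sockets of the data at the common rate `1/n` -/

/-- [our object] **THE GHOST SECOND-ORDER KINETIC TABLE OF RECORD** (owner R-4 (i)): `ghXTab cW κ u := (cW/2) • ghX κ u` — the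
exponential transporter's reversal-symmetric same-bond cross contact with external weight `cW/2`.  A DEFINITION; asserts nothing; which
`cW` Bałaban's ghost action carries is the owner's CHECK-N0, not this file's. -/
def ghXTab (cW : ℝ) : Fin 4 → Site 4 → MKer 4 Unit := fun κ' u => (cW / 2) • ghX κ' u

/-- [our object] Unfolding `ghXTab`. -/
theorem ghXTab_apply (cW : ℝ) (κ' : Fin 4) (u : Site 4) : ghXTab cW κ' u = (cW / 2) • ghX κ' u := rfl

variable (n : ℕ) [NeZero n] (cW : ℝ)

omit [NeZero n] in
/-- [folklore] The kinetic table is bi-localised at its bond at rate `1/n` (`biLoc_ghX` + leaf-04's `biLoc_smul'`). -/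
theorem biLoc_ghXTab (κ' : Fin 4) (u : Site 4) : BiLoc (ghXTab cW κ' u) u u (|cW / 2| * Real.exp (1 / n)) (1 / n) :=
  biLoc_smul' (cW / 2) (biLoc_ghX κ' u (1 / (n : ℝ)))

omit [NeZero n] in
/-- [folklore] Its diagonal extension is bi-localised at its two bonds at rate `1/n` (`ReducedKernelSandwichBlock.biLoc_diagExt`). -/
theorem biLoc_diagExt_ghXTab (κ' : Fin 4) (u : Site 4) (l' : Fin 4) (u' : Site 4) :
    BiLoc (diagExt (ghXTab cW) κ' u l' u') u u' (|cW / 2| * Real.exp (1 / n)) (1 / n) :=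
  biLoc_diagExt (ghXTab cW) (fun κ' u => biLoc_ghXTab n cW κ' u) (by positivity) κ' u l' u'

omit [NeZero n] in
/-- [folklore] Block covariance of the kinetic table (indeed covariance under every fine translation, `ghX_translate`). -/
theorem ghXTab_translate (κ' : Fin 4) (u t : Site 4) :
    ghXTab cW κ' (u + (n : ℤ) • t) = shiftK (-((n : ℤ) • t)) (ghXTab cW κ' u) := by
  simp only [ghXTab_apply, ghX_translate κ' u ((n : ℤ) • t), shiftK_smul]

omit [NeZero n] in
/-- [folklore] Block covariance of its diagonal extension (`ReducedKernelSandwichBlock.diagExt_translate`). -/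
theorem diagExt_ghXTab_translate (κ' : Fin 4) (u : Site 4) (l' : Fin 4) (u' t : Site 4) :
    diagExt (ghXTab cW) κ' (u + (n : ℤ) • t) l' (u' + (n : ℤ) • t) = shiftK (-((n : ℤ) • t)) (diagExt (ghXTab cW) κ' u l' u') :=
  diagExt_translate (ghXTab cW) (fun t : Site 4 => (n : ℤ) • t) (fun κ' u t => ghXTab_translate n cW κ' u t) κ' u l' u' t

/-- [folklore] Symmetry of the diagonal extension (`diagExt_symm`). -/
theorem diagExt_ghXTab_symm (κ' : Fin 4) (u : Site 4) (l' : Fin 4) (u' : Site 4) :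
    diagExt (ghXTab cW) κ' u l' u' = diagExt (ghXTab cW) l' u' κ' u :=
  diagExt_symm (ghXTab cW) κ' u l' u'

/-- [folklore] **INVERSION LAW OF THE KINETIC TABLE WITH THE CURRENT'S OFFSET** (leaf-01's `smul_ghX_pointInversion`):
`ghXTab cW κ (cInv n κ − u) = refK (invLeg n) (ghXTab cW κ u)`. -/
theorem ghXTab_pointInversion (κ' : Fin 4) (u : Site 4) : ghXTab cW κ' (cInv n κ' - u) = refK (invLeg n) (ghXTab cW κ' u) :=
  smul_ghX_pointInversion n κ' u (cW / 2)

/-- [folklore] … hence the two-bond law of its diagonal extension with bond signs `(−1)·(−1)` (`FineHessianReflection.diagExt_refl`). -/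
theorem diagExt_ghXTab_pointInversion (κ' : Fin 4) (u : Site 4) (l' : Fin 4) (u' : Site 4) :
    diagExt (ghXTab cW) κ' (cInv n κ' - u) l' (cInv n l' - u') = ((-1 : ℝ) * (-1 : ℝ)) • refK (invLeg n) (diagExt (ghXTab cW) κ' u l' u') :=
  diagExt_refl (invLeg n) (T := ghXTab cW) (fun κ u => cInv n κ - u) (fun _ _ _ h => sub_right_injective h) (fun _ => (-1 : ℝ))
    (fun _ => by norm_num) (fun κ u => ghXTab_pointInversion n cW κ u) κ' u l' u'

variable (cK cQ : ℝ)

/-- [folklore] The centre-rooted stencil's socket at `δ := 1`: `BiLoc (SghAt (ctrHalf n) n cK cQ κ u) u u (|cK|·e^{1/n} + |cQ|·(8/n³)·e⁸) (1/n)`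
(leaf-01's `biLoc_SghAt` at the in-block root `ctrHalf_mem`). -/
theorem biLoc_SghAt_ctr (κ' : Fin 4) (u : Site 4) :
    BiLoc (SghAt (ctrHalf n) n cK cQ κ' u) u u (|cK| * Real.exp (1 / n) + |cQ| * (8 / (n : ℝ) ^ 3 * Real.exp (8 * 1))) (1 / n) :=
  biLoc_SghAt n κ' u (ctrHalf_mem n) cK cQ zero_le_one

/-- [folklore] Block covariance of the centre-rooted stencil (leaf-01's `SghAt_translate_block`). -/
theorem SghAt_ctr_translate_block (κ' : Fin 4) (u t : Site 4) :
    SghAt (ctrHalf n) n cK cQ κ' (u + (n : ℤ) • t) = shiftK (-((n : ℤ) • t)) (SghAt (ctrHalf n) n cK cQ κ' u) :=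
  SghAt_translate_block (ctrHalf n) n cK cQ κ' u t

/-! ## §2 The centred ghost sector over a generic fine two-bond table -/

section GenericTable

variable (a : ℝ) {Wf : Fin 4 → Site 4 → Fin 4 → Site 4 → MKer 4 Unit} {C2 : ℝ}

/-- [folklore] **A4 / K-R5 FOR THE CENTRED GHOST SECTOR OVER ANY FINE TABLE — PARITY DISCHARGED** (`0 < a`, `n` ODD): for a fine two-bond
table `Wf` bi-localised at rate `1/n`, block covariant, symmetric, and obeying the inversion law with the current's offset
`Wf κ (cInv n κ − u) λ (cInv n λ − u′) = refK (invLeg n) (Wf κ u λ u′)`, the coarse bond second moment of the dressed ghost kernel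
`TOfGh n a (SghAt (ctrHalf n) n cK cQ) (tableRedF n Wf)` is the base-point block average of the fine one, GIVEN ONLY the Ward rows `hrow` of
`fineHessA (Ggh n a) (SghAt (ctrHalf n) n cK cQ) Wf` — the `hinv` input of the chain is supplied by `SghAt_pointInversion` (sign `−1` on
every bond), `refK_invLeg_Ggh` and `FineHessianReflection.fineHessA_inversion`. -/
theorem bondSecondMoment_TOfGh_ctr_eq_avgM2_of_tableLaw (ha : 0 < a) (hodd : Odd n)
    (hW : ∀ κ' u l' u', BiLoc (Wf κ' u l' u') u u' C2 (1 / n))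
    (hWcov : ∀ (κ' : Fin 4) (u : Site 4) (l' : Fin 4) (u' t : Site 4),
      Wf κ' (u + (n : ℤ) • t) l' (u' + (n : ℤ) • t) = shiftK (-((n : ℤ) • t)) (Wf κ' u l' u'))
    (hWsymm : ∀ (κ' : Fin 4) (u : Site 4) (l' : Fin 4) (u' : Site 4), Wf κ' u l' u' = Wf l' u' κ' u)
    (hrow : ∀ (κ' l' : Fin 4) (b : Site 4), HasSum (fineHessA (Ggh n a) (SghAt (ctrHalf n) n cK cQ) Wf κ' l' b) 0)
    (hWr : ∀ κ' u l' u', Wf κ' (cInv n κ' - u) l' (cInv n l' - u') = refK (invLeg n) (Wf κ' u l' u'))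
    (κ lam μ ν : Fin 4) :
    ∑' z : Site 4, ((z κ * z lam : ℤ) : ℝ) * ((n : ℝ) ^ 8 * TOfGh n a (SghAt (ctrHalf n) n cK cQ) (tableRedF n Wf) μ ν z)
      = avgM2 n (fineHessA (Ggh n a) (SghAt (ctrHalf n) n cK cQ) Wf μ ν) κ lam := by
  have hn : (0 : ℝ) < 1 / (n : ℝ) := div_pos one_pos (by exact_mod_cast Nat.pos_of_ne_zero (NeZero.ne n))
  have hWr' : ∀ κ' u l' u', Wf κ' (cInv n κ' - u) l' (cInv n l' - u')
      = ((fun _ : Fin 4 => (-1 : ℝ)) κ' * (fun _ : Fin 4 => (-1 : ℝ)) l') • refK (invLeg n) (Wf κ' u l' u') := fun κ' u l' u' => by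
    rw [hWr κ' u l' u']
    norm_num
  exact bondSecondMoment_TOfLeg_eq_avgM2_of_refl (Ggh n a) n (spr_Ggh n a ha) (shiftK_Ggh_neg n a ha) (biLoc_SghAt_ctr n cK cQ) hW hn
    (SghAt_ctr_translate_block n cK cQ) hWcov hWsymm hrow (invLeg n) (refK_invLeg_Ggh n a ha) (cInv n) (fun _ => (-1 : ℝ))
    (fun _ _ => by norm_num) (fun κ' u => SghAt_pointInversion n hodd cK cQ κ' u) hWr' κ lam μ ν

/-- [folklore] **A4 / K-R5 FOR THE CENTRED GHOST SECTOR FROM SOCKETS ONLY, ON THE WARD RAY** (`0 < a`, `n` ODD, weights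
`(cK, cQ) = (c·n², c·a)`): (W1) is leaf-01's `ward₁_Ggh_rooted` with the generator family `X u := (−c) • genX u`, parity as above; the ONE
remaining table-side LAW is (W2) `divW Wf u λ u′ = X u ∘ SghAt λ u′ − SghAt λ u′ ∘ X u` (besides the table's sockets and inversion law) —
then NO hypothesis on the composite kernel remains (`FineHessianWard.bondSecondMoment_TOfLeg_eq_avgM2_of_laws`). -/
theorem bondSecondMoment_TOfGh_ctr_eq_avgM2_of_laws (ha : 0 < a) (hodd : Odd n) (c : ℝ)
    (hW : ∀ κ' u l' u', BiLoc (Wf κ' u l' u') u u' C2 (1 / n))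
    (hWcov : ∀ (κ' : Fin 4) (u : Site 4) (l' : Fin 4) (u' t : Site 4),
      Wf κ' (u + (n : ℤ) • t) l' (u' + (n : ℤ) • t) = shiftK (-((n : ℤ) • t)) (Wf κ' u l' u'))
    (hWsymm : ∀ (κ' : Fin 4) (u : Site 4) (l' : Fin 4) (u' : Site 4), Wf κ' u l' u' = Wf l' u' κ' u)
    (hW2 : ∀ (u : Site 4) (l' : Fin 4) (u' : Site 4), divW Wf u l' u'
      = comp ((-c) • genX u) (SghAt (ctrHalf n) n (c * (n : ℝ) ^ 2) (c * a) l' u')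
        - comp (SghAt (ctrHalf n) n (c * (n : ℝ) ^ 2) (c * a) l' u') ((-c) • genX u))
    (hWr : ∀ κ' u l' u', Wf κ' (cInv n κ' - u) l' (cInv n l' - u') = refK (invLeg n) (Wf κ' u l' u'))
    (κ lam μ ν : Fin 4) :
    ∑' z : Site 4, ((z κ * z lam : ℤ) : ℝ) *
        ((n : ℝ) ^ 8 * TOfGh n a (SghAt (ctrHalf n) n (c * (n : ℝ) ^ 2) (c * a)) (tableRedF n Wf) μ ν z)
      = avgM2 n (fineHessA (Ggh n a) (SghAt (ctrHalf n) n (c * (n : ℝ) ^ 2) (c * a)) Wf μ ν) κ lam := by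
  have hn : (0 : ℝ) < 1 / (n : ℝ) := div_pos one_pos (by exact_mod_cast Nat.pos_of_ne_zero (NeZero.ne n))
  have hWr' : ∀ κ' u l' u', Wf κ' (cInv n κ' - u) l' (cInv n l' - u')
      = ((fun _ : Fin 4 => (-1 : ℝ)) κ' * (fun _ : Fin 4 => (-1 : ℝ)) l') • refK (invLeg n) (Wf κ' u l' u') := fun κ' u l' u' => by
    rw [hWr κ' u l' u']
    norm_num
  exact bondSecondMoment_TOfLeg_eq_avgM2_of_laws (Ggh n a) n (spr_Ggh n a ha) (shiftK_Ggh_neg n a ha)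
    (biLoc_SghAt_ctr n (c * (n : ℝ) ^ 2) (c * a)) hW hn (SghAt_ctr_translate_block n (c * (n : ℝ) ^ 2) (c * a)) hWcov hWsymm
    (fun u => (-c) • genX u) (fun u => biLoc_smul_genX c u (1 / (n : ℝ))) (fun u => ward₁_Ggh_rooted n (ctrHalf_mem n) ha c u) hW2
    (invLeg n) (refK_invLeg_Ggh n a ha) (cInv n) (fun _ => (-1 : ℝ)) (fun _ _ => by norm_num)
    (fun κ' u => SghAt_pointInversion n hodd (c * (n : ℝ) ^ 2) (c * a) κ' u) hWr' κ lam μ ν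

end GenericTable

/-! ## §3 The ruled literal: T7-gh v1.1 -/

/-- [our object] **T7-gh v1.1 — THE GHOST FINE ONE-SHOT KERNEL OF RECORD** at block size `n`, averaging weight `a`, real weights `cK cQ cW`:
`PghR n a cK cQ cW := TOfGh n a (SghAt (ctrHalf n) n cK cQ) (tableRedF n (diagExt (ghXTab cW)))` — the ghost leg (T2) with the
centre-rooted first-order stencil (T6-ρ) and the dressed kinetic cross-contact table, in the reduced Hessian shape (T8-gh), written in the
generic chain's format.  The loop weight of leaf R1 (owner R-4 (v): `−2`) is NOT applied.  A DEFINITION; asserts nothing. -/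
def PghR (n : ℕ) [NeZero n] (a cK cQ cW : ℝ) : Fin 4 → Fin 4 → Site 4 → ℝ :=
  TOfGh n a (SghAt (ctrHalf n) n cK cQ) (tableRedF n (diagExt (ghXTab cW)))

/-- [our object] **THE FINE GHOST HESSIAN KERNEL OF THE RULED TRIPLE**: `fineHessGhR n a cK cQ cW := fineHessA (Ggh n a)
(SghAt (ctrHalf n) n cK cQ) (diagExt (ghXTab cW))`.  A DEFINITION; asserts nothing. -/
def fineHessGhR (n : ℕ) [NeZero n] (a cK cQ cW : ℝ) : EKer₂ 4 :=
  fineHessA (Ggh n a) (SghAt (ctrHalf n) n cK cQ) (diagExt (ghXTab cW))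

variable (a : ℝ)

/-- [our object] Unfolding `PghR` in the generic chain's format. -/
theorem PghR_eq : PghR n a cK cQ cW = TOfGh n a (SghAt (ctrHalf n) n cK cQ) (tableRedF n (diagExt (ghXTab cW))) := rfl

/-- [our object] … over the generic leg: `PghR n a cK cQ cW = TOfLeg n (Ggh n a) (SghAt (ctrHalf n) n cK cQ) (tableRedF n (diagExt (ghXTab cW)))`. -/
theorem PghR_eq_TOfLeg :
    PghR n a cK cQ cW = TOfLeg n (Ggh n a) (SghAt (ctrHalf n) n cK cQ) (tableRedF n (diagExt (ghXTab cW))) := rfl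

/-- [our object] … as a `hessKer`: `PghR n a cK cQ cW = hessKer (Ggh n a) (vertexRedF n (SghAt (ctrHalf n) n cK cQ)) (tableRedF n (diagExt (ghXTab cW)))`. -/
theorem PghR_eq_hessKer :
    PghR n a cK cQ cW = hessKer (Ggh n a) (vertexRedF n (SghAt (ctrHalf n) n cK cQ)) (tableRedF n (diagExt (ghXTab cW))) := rfl

/-- [our object] Unfolding `fineHessGhR`. -/
theorem fineHessGhR_eq : fineHessGhR n a cK cQ cW = fineHessA (Ggh n a) (SghAt (ctrHalf n) n cK cQ) (diagExt (ghXTab cW)) := rfl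

/-- [folklore] **BLOCK COVARIANCE OF THE RULED DATA** (`0 < a`): `BlockCovariant (Ggh n a) (vertexRedF n (SghAt (ctrHalf n) n cK cQ))
(tableRedF n (diagExt (ghXTab cW))) n` (leaf-04's block twin `vertexRedF_translate_block` + `ReducedTableF.tableRedF_translate`). -/
theorem blockCovariant_PghR (ha : 0 < a) :
    BlockCovariant (Ggh n a) (vertexRedF n (SghAt (ctrHalf n) n cK cQ)) (tableRedF n (diagExt (ghXTab cW))) n :=
  ⟨fun t => shiftK_Ggh_neg n a ha t,
   fun μ y t => vertexRedF_translate_block n (fun κ' u t => SghAt_ctr_translate_block n cK cQ κ' u t) μ y t,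
   fun μ y ν y' t => tableRedF_translate n (fun κ' u l' u' t => diagExt_ghXTab_translate n cW κ' u l' u' t) μ y ν y' t⟩

/-- [folklore] **BASE POINT**: `hess (Ggh n a) (vertexRedF n (SghAt …)) (tableRedF n (diagExt (ghXTab cW))) μ y ν y′ = PghR n a cK cQ cW μ ν (y′ − y)`. -/
theorem hess_eq_PghR (ha : 0 < a) (μ : Fin 4) (y : Site 4) (ν : Fin 4) (y' : Site 4) :
    hess (Ggh n a) (vertexRedF n (SghAt (ctrHalf n) n cK cQ)) (tableRedF n (diagExt (ghXTab cW))) μ y ν y' =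
      PghR n a cK cQ cW μ ν (y' - y) :=
  hess_eq_hessKer (blockCovariant_PghR n cW cK cQ a ha) μ y ν y'

/-- [folklore] The dressed centre-rooted ghost vertex is a vertex family, with SOME constant and a positive rate (`vertexFamily_vertexRedF'`). -/
theorem exists_vertexFamily_SghAt_ctr : ∃ Cv δv : ℝ, 0 < δv ∧ VertexFamily (vertexRedF n (SghAt (ctrHalf n) n cK cQ)) n Cv δv := by
  have hn : (0 : ℝ) < 1 / (n : ℝ) := div_pos one_pos (by exact_mod_cast Nat.pos_of_ne_zero (NeZero.ne n))
  obtain ⟨Cv, δv, hδv, -, hV⟩ := vertexFamily_vertexRedF' n (biLoc_SghAt_ctr n cK cQ) hn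
  exact ⟨Cv, δv, hδv, hV⟩

/-- [folklore] The dressed kinetic table is a second-order vertex family, with SOME constant and a positive rate (`vertexFamily₂_tableRedF'`). -/
theorem exists_vertexFamily₂_ghXTab : ∃ C2 δ2 : ℝ, 0 < δ2 ∧ VertexFamily₂ (tableRedF n (diagExt (ghXTab cW))) n C2 δ2 := by
  have hn : (0 : ℝ) < 1 / (n : ℝ) := div_pos one_pos (by exact_mod_cast Nat.pos_of_ne_zero (NeZero.ne n))
  obtain ⟨C2, δ2, hδ2, -, hW⟩ := vertexFamily₂_tableRedF' n (biLoc_diagExt_ghXTab n cW) hn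
  exact ⟨C2, δ2, hδ2, hW⟩

/-- [folklore] **T7-gh v1.1 IS WELL-TYPED** — `AbsMoment₂ (PghR n a cK cQ cW μ ν)` for every channel, every block size `n ≥ 1`, every `a > 0`
and all real weights; NO other hypothesis. -/
theorem absMoment₂_PghR (ha : 0 < a) (μ ν : Fin 4) : AbsMoment₂ (PghR n a cK cQ cW μ ν) := by
  obtain ⟨Cv, δv, hδv, hV⟩ := exists_vertexFamily_SghAt_ctr n cK cQ
  obtain ⟨C2, δ2, hδ2, hW⟩ := exists_vertexFamily₂_ghXTab n cW
  exact absMoment₂_TOfGh n a ha hV hδv hW hδ2 μ ν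

/-- [folklore] **(5.10)-SHAPE DECAY OF EVERY CHANNEL OF T7-gh v1.1**, with SOME constant and positive rate (per `n`; the ghost rate is `∝ 1/n`):
`∃ C δ, 0 < δ ∧ ∀ μ ν, Decay510 (PghR n a cK cQ cW μ ν) C δ` (`ExpKernelCalculus.hdec_hessKer`, rates matched by monotonicity). -/
theorem exists_decay510_PghR (ha : 0 < a) : ∃ C δ : ℝ, 0 < δ ∧ ∀ μ ν : Fin 4, Decay510 (PghR n a cK cQ cW μ ν) C δ := by
  have hn1 : 1 ≤ n := NeZero.one_le
  have hn : (0 : ℝ) < n := by exact_mod_cast hn1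
  obtain ⟨Cv, δv, hδv, hV⟩ := exists_vertexFamily_SghAt_ctr n cK cQ
  obtain ⟨C2, δ2, hδ2, hW⟩ := exists_vertexFamily₂_ghXTab n cW
  have hA := decays_Ggh n a ha
  have hrate : 0 < deltaU 4 a / (4 * (n : ℝ)) := by have := deltaU_pos 4 ha; positivity
  set δ' : ℝ := min (deltaU 4 a / (4 * (n : ℝ))) (min δv δ2) with hδ'
  have hδ'pos : 0 < δ' := lt_min hrate (lt_min hδv hδ2)
  have hCv : 0 ≤ Cv := (hV 0 0).nonneg ()
  have hC2 : 0 ≤ C2 := (hW 0 0 0 0).nonneg ()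
  have hA' : Decays (Ggh n a) (2 / min 2 a) δ' := decays_mono hA (const_nonneg a ha) le_rfl (min_le_left _ _)
  have hV' : VertexFamily (vertexRedF n (SghAt (ctrHalf n) n cK cQ)) n Cv δ' := fun μ y =>
    biLoc_mono (hV μ y) hCv ((min_le_right _ _).trans (min_le_left _ _))
  have hW' : VertexFamily₂ (tableRedF n (diagExt (ghXTab cW))) n C2 δ' := fun μ y ν y' =>
    biLoc_mono (hW μ y ν y') hC2 ((min_le_right _ _).trans (min_le_right _ _))
  obtain ⟨C', δ'', hδ'', h⟩ := hdec_hessKer hA' hV' hW' hδ'pos hn1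
  exact ⟨C', δ'', hδ'', fun μ ν => h μ ν⟩

/-- [folklore] **T7-gh v1.1 IS AN `ℋ`-SANDWICH** (`0 < a`; NO other hypothesis):
`PghR n a cK cQ cW μ ν z = dressedEntryP (wK n) (fineHessGhR n a cK cQ cW) (n•(−z)) μ ν`. -/
theorem PghR_eq_dressedEntryP (ha : 0 < a) (μ ν : Fin 4) (z : Site 4) :
    PghR n a cK cQ cW μ ν z = dressedEntryP (wK n) (fineHessGhR n a cK cQ cW) ((n : ℤ) • (-z)) μ ν := by
  have hn : (0 : ℝ) < 1 / (n : ℝ) := div_pos one_pos (by exact_mod_cast Nat.pos_of_ne_zero (NeZero.ne n))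
  rw [PghR_eq_TOfLeg, fineHessGhR_eq]
  exact TOfLeg_tableRedF_eq_dressedEntryP_of_block n (Ggh n a) (spr_Ggh n a ha) (shiftK_Ggh_neg n a ha) (biLoc_SghAt_ctr n cK cQ)
    (biLoc_diagExt_ghXTab n cW) hn (SghAt_ctr_translate_block n cK cQ) (diagExt_ghXTab_translate n cW) μ ν z

/-- [folklore] **A4 FOR T7-gh v1.1 — THE DRESSING CROSS TERMS VANISH** (`0 < a`), GIVEN (hypotheses — the road's Ward (A3.b) and parity
(R5-(T1)) inputs) that every entry of `fineHessGhR n a cK cQ cW` has rows summing to zero and base-point-summed first moments zero: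
`Σ'_z z_κ z_λ · n⁸ · PghR n a cK cQ cW μ ν z = avgM2 n (fineHessGhR n a cK cQ cW μ ν) κ λ`. -/
theorem bondSecondMoment_PghR_eq_avgM2 (ha : 0 < a)
    (hrow : ∀ (κ' l' : Fin 4) (b : Site 4), HasSum (fineHessGhR n a cK cQ cW κ' l' b) 0)
    (hT1 : ∀ (κ' l' μ' : Fin 4),
      ∑ r : Fin 4 → Fin n, ∑' t, (t μ' : ℝ) * baseKer (fineHessGhR n a cK cQ cW κ' l') (resSite r) t = 0)
    (κ lam μ ν : Fin 4) :
    ∑' z : Site 4, ((z κ * z lam : ℤ) : ℝ) * ((n : ℝ) ^ 8 * PghR n a cK cQ cW μ ν z)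
      = avgM2 n (fineHessGhR n a cK cQ cW μ ν) κ lam := by
  have hn : (0 : ℝ) < 1 / (n : ℝ) := div_pos one_pos (by exact_mod_cast Nat.pos_of_ne_zero (NeZero.ne n))
  rw [PghR_eq_TOfLeg]
  exact bondSecondMoment_TOfLeg_eq_avgM2_of_block n (Ggh n a) (spr_Ggh n a ha) (shiftK_Ggh_neg n a ha) (biLoc_SghAt_ctr n cK cQ)
    (biLoc_diagExt_ghXTab n cW) hn (SghAt_ctr_translate_block n cK cQ) (diagExt_ghXTab_translate n cW) (diagExt_ghXTab_symm cW)
    hrow hT1 κ lam μ ν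

/-- [folklore] The same in `B12Beta.secondMoment` currency: `Σ'_z PghR n a cK cQ cW μ ν z · z_κ · z_λ = n⁻⁸ · avgM2 n (fineHessGhR … μ ν) κ λ`. -/
theorem secondMoment_PghR_eq (ha : 0 < a)
    (hrow : ∀ (κ' l' : Fin 4) (b : Site 4), HasSum (fineHessGhR n a cK cQ cW κ' l' b) 0)
    (hT1 : ∀ (κ' l' μ' : Fin 4),
      ∑ r : Fin 4 → Fin n, ∑' t, (t μ' : ℝ) * baseKer (fineHessGhR n a cK cQ cW κ' l') (resSite r) t = 0)
    (κ lam μ ν : Fin 4) :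
    ∑' z : Site 4, PghR n a cK cQ cW μ ν z * (z κ : ℝ) * (z lam : ℝ)
      = ((n : ℝ) ^ 8)⁻¹ * avgM2 n (fineHessGhR n a cK cQ cW μ ν) κ lam := by
  have hn : (0 : ℝ) < 1 / (n : ℝ) := div_pos one_pos (by exact_mod_cast Nat.pos_of_ne_zero (NeZero.ne n))
  rw [PghR_eq_TOfLeg]
  exact secondMoment_TOfLeg_eq_of_block n (Ggh n a) (spr_Ggh n a ha) (shiftK_Ggh_neg n a ha) (biLoc_SghAt_ctr n cK cQ)
    (biLoc_diagExt_ghXTab n cW) hn (SghAt_ctr_translate_block n cK cQ) (diagExt_ghXTab_translate n cW) (diagExt_ghXTab_symm cW)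
    hrow hT1 κ lam μ ν

/-- [folklore] **A4 FOR T7-gh v1.1, PARITY DISCHARGED** (`0 < a`, `n` ODD) — the reason for the re-rooting: the first-moment / inversion
input of the chain is a THEOREM for the ruled triple (`SghAt_pointInversion`, `diagExt_ghXTab_pointInversion`, `refK_invLeg_Ggh`), so the
coarse bond second moment of `PghR` is the base-point block average of the fine one GIVEN ONLY the Ward rows `hrow` of `fineHessGhR`
(node A3.b; see the header for why `hrow` is not derivable from (W1)/(W2) for the kinetic-only table at `cQ ≠ 0`). -/
theorem bondSecondMoment_PghR_eq_avgM2_of_wardRows (ha : 0 < a) (hodd : Odd n)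
    (hrow : ∀ (κ' l' : Fin 4) (b : Site 4), HasSum (fineHessGhR n a cK cQ cW κ' l' b) 0)
    (κ lam μ ν : Fin 4) :
    ∑' z : Site 4, ((z κ * z lam : ℤ) : ℝ) * ((n : ℝ) ^ 8 * PghR n a cK cQ cW μ ν z)
      = avgM2 n (fineHessGhR n a cK cQ cW μ ν) κ lam := by
  rw [PghR_eq, fineHessGhR_eq]
  exact bondSecondMoment_TOfGh_ctr_eq_avgM2_of_tableLaw n cK cQ a ha hodd (biLoc_diagExt_ghXTab n cW) (diagExt_ghXTab_translate n cW)
    (diagExt_ghXTab_symm cW) hrow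
    (fun κ' u l' u' => by rw [diagExt_ghXTab_pointInversion n cW κ' u l' u']; norm_num) κ lam μ ν

/-! ## §4 The first-order Ward socket of the ruled triple, for the record -/

/-- [folklore] **(W1) FOR THE RULED LEG AND STENCIL ON THE WARD RAY** (`0 < a`, every `n ≥ 1`, every real `c`; leaf-01's `ward₁_Ggh_rooted`
at the centred root): `(Ggh ∘ divV (SghAt (ctrHalf n) n (c·n²) (c·a)) u) ∘ Ggh = Ggh ∘ X u − X u ∘ Ggh`, `X u = (−c) • genX u` — the `hW1`
socket of `FineHessianWard.bondSecondMoment_TOfLeg_eq_avgM2_of_laws` for T7-gh v1.1's first-order data. -/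
theorem ward₁_SghAt_ctr (ha : 0 < a) (c : ℝ) (u : Site 4) :
    comp (comp (Ggh n a) (divV (SghAt (ctrHalf n) n (c * (n : ℝ) ^ 2) (c * a)) u)) (Ggh n a)
      = comp (Ggh n a) ((-c) • genX u) - comp ((-c) • genX u) (Ggh n a) :=
  ward₁_Ggh_rooted n (ctrHalf_mem n) ha c u

end Summit.QuantumFields.BalabanUV.Beta.D1BFx.GhostKernelRooted

end
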